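import Mathlib.Data.Finsupp.Weight
import Mathlib.Algebra.BigOperators.Finsupp.Basic
import Mathlib.Algebra.Order.Archimedean.Basic
import Summits.KontsevichZagierPeriods.KontsevichZagierPeriods.Theorems.FurushoPentagonSectorToKernelAdmissibleOfTameSeries
import Summits.KontsevichZagierPeriods.KontsevichZagierPeriods.Theorems.FurushoPentagonSectorToKernelAdmissibleOfTameSubdiv
import Literature.NumberTheory.Transcendental.KZCalculusProofs
import Literature.NumberTheory.Transcendental.KZCubicalCalculus
import Literature.NumberTheory.Transcendental.KZGroundingRelations
import Literature.NumberTheory.Transcendental.KZLogCalculusProofs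
import Literature.NumberTheory.Transcendental.SemialgebraicMapsProofs

/-!
# `StokesGeneration` (stmt-KontsevichZagierPeriods-3586), line `Sketch`: stub `stub_nashToGerm`

Support file for the registered stub `stub_nashToGerm` (N₂) of the crux `StokesGeneration`
(route UnfoldedStokes, line `Sketch` = card cube-type-a-generation). Statement: a closed-cube
representation `s = [[0,1]ⁿ, f]` of the Kontsevich–Zagier calculus whose integrand agrees on the
closed cube with a function `g` that is `ℚ`-semialgebraic and real-analytic on an open `U ⊇ [0,1]ⁿ`
is congruent modulo the moves (`KZ.relations`) to ONE closed-cube representation `t` of the same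
dimension whose integrand `h` is `ℚ`-semialgebraic on an open `V ⊇ [0,1]ⁿ` and is, on the closed
cube, the sum of a real power series `Σₐ cₐ xᵃ` at the corner `0` with `Σₐ |cₐ| R^{|a|} < ∞` for some
`R > 1` (here `R = 2`).

## Proof

The analysis and the move bookkeeping are those of the tree's theorem `stub_admissibleOfTame`
(crux `FurushoPentagon.SectorToKernel`, files `…SectorToKernelAdmissibleOfTameSeries.lean`,
`…AdmissibleOfTameSubdivAux.lean`, `…AdmissibleOfTameSubdiv.lean`, imported):

* (uniform radius) by compactness of the cube and `HasFPowerSeriesOnBall.changeOrigin`, `g` has a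
  power series expansion of one radius `δ > 0` about every point of the closed cube
  (`admOfTame_exists_uniform_radius`);
* (grid) for `N = 2ʲ` with `N δ > 2n`, `[[0,1]ⁿ, g] ∼ [[0,1]ⁿ, h]` with the AVERAGE
  `h x = ∑_{k ∈ {0,…,N-1}ⁿ} N⁻ⁿ g((k + x)/N)`, by `j` rounds of the dyadic subdivision move along each
  coordinate (`KZ.cubicalSubdivGens_subset_relations`: domain additivity across the null hyperplane
  `xᵢ = ½` and two affine changes of variables of Jacobian `½`) re-summed by integrand additivity
  (`admOfTame_rel_avg`); `[s] ∼ [[0,1]ⁿ, g]` since the integrands agree on the common domain;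
* (series) each summand of `h` is `g` re-expanded about the grid point `k/N ∈ [0,1]ⁿ` and rescaled
  by `N`, so `h` has a power series at `0` of sup-radius `N δ > 2n`
  (`hasFPowerSeriesOnBall_avg`), which regroups — expanding the multilinear terms along
  `x = ∑ xᵢ eᵢ` and collecting monomials — into one multivariable power series with
  `∑ₐ |cₐ| 2^{|a|} < ∞` summing to `h` on the closed cube (`admOfTame_exists_mvPowerSeries`);
* (semialgebraicity near the cube) `h` is `ℚ`-semialgebraic on the open set
  `V = ⋂ₖ Φₖ⁻¹ U ⊇ [0,1]ⁿ`, `Φₖ x = (k + x)/N` a polynomial map over `ℚ` (preimages of the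
  semialgebraic `U`, composition `g ∘ Φₖ` by `IsSemialgebraicFunOn.comp_isSemialgebraicMapOn_holds`,
  rational constants and finite sums).

References: M. Kontsevich, D. Zagier, *Periods* (2001), §1.2 rules (1)–(2); J. Ayoub, *Periods and
the conjectures of Grothendieck and Kontsevich–Zagier*, EMS Newsl. 91 (2014), §2.2, Def. 9 and
Rem. 12; S. G. Krantz, H. R. Parks, *A Primer of Real Analytic Functions* (2002), §2.2.
-/

noncomputable section

-- `Summit.KontsevichZagierPeriods.KontsevichZagierPeriods.…` is the tree's mandated layout (single-conjunct summit).
set_option linter.dupNamespace false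

namespace Summit.KontsevichZagierPeriods.KontsevichZagierPeriods.StokesGenerationLine

open MeasureTheory Set
open Literature.NumberTheory.Transcendental
open Literature.NumberTheory.Transcendental.KZ
open Summit.KontsevichZagierPeriods.FurushoPentagon.SectorToKernel
open scoped NNReal ENNReal

/-! ## The grid maps `x ↦ (k + x)/N` -/

/-- The grid points `k/N`, `k ∈ {0, …, N-1}ⁿ`, lie in the closed unit cube. [folklore] -/
private theorem gridPoint_mem_cube {n N : ℕ} (k : Fin n → Fin N) :
    (fun j => (((k j : Fin N) : ℕ) : ℝ) / N) ∈ KZ.cube n := by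
  -- adapted from `admOfTame_latticePoint_mem_cube` (…SectorToKernelAdmissibleOfTame.lean)
  intro j
  have hN : (0 : ℝ) < N := by exact_mod_cast (k j).pos
  have hk : (((k j : Fin N) : ℕ) : ℝ) + 1 ≤ N := by exact_mod_cast (k j).2
  refine ⟨div_nonneg (Nat.cast_nonneg _) hN.le, ?_⟩
  rw [div_le_one hN]
  linarith

/-- The grid map `x ↦ (k + x)/N`, `k ∈ {0, …, N-1}ⁿ`, sends the closed unit cube into itself.
[folklore] -/
private theorem gridMap_mem_cube {n N : ℕ} (k : Fin n → Fin N) {x : Fin n → ℝ}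
    (hx : x ∈ KZ.cube n) :
    (fun j => ((((k j : Fin N) : ℕ) : ℝ) + x j) / N) ∈ KZ.cube n := by
  intro j
  have hN : (0 : ℝ) < N := by exact_mod_cast (k j).pos
  have hk : (((k j : Fin N) : ℕ) : ℝ) + 1 ≤ N := by exact_mod_cast (k j).2
  have hk0 : (0 : ℝ) ≤ (((k j : Fin N) : ℕ) : ℝ) := Nat.cast_nonneg _
  have hxj := KZ.mem_cube.1 hx j
  refine ⟨div_nonneg (by linarith [hxj.1]) hN.le, ?_⟩
  rw [div_le_one hN]
  linarith [hxj.2]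

/-- The grid map `x ↦ (k + x)/N` is the polynomial map `(C (kⱼ/N) + C N⁻¹ · Xⱼ)ⱼ` over `ℚ`.
[folklore] -/
private theorem aeval_gridPoly {n N : ℕ} (k : Fin n → Fin N) (x : Fin n → ℝ) (j : Fin n) :
    MvPolynomial.aeval x (MvPolynomial.C ((((k j : Fin N) : ℕ) : ℚ) / N) +
        MvPolynomial.C ((N : ℚ)⁻¹) * MvPolynomial.X j : MvPolynomial (Fin n) ℚ) =
      ((((k j : Fin N) : ℕ) : ℝ) + x j) / N := by
  simp
  ring

/-! ## Semialgebraicity of the average near the cube -/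

/-- **The average is `ℚ`-semialgebraic near the cube.** If `g` is `ℚ`-semialgebraic on `U`, then
`x ↦ ∑_{k ∈ {0,…,N-1}ⁿ} N⁻ⁿ g((k + x)/N)` is `ℚ`-semialgebraic on `⋂ₖ Φₖ⁻¹ U`, `Φₖ x = (k + x)/N`
(preimages of a semialgebraic set under polynomial maps, composition with polynomial maps —
Tarski–Seidenberg —, rational constants, finite sums). [Bochnak–Coste–Roy 1998, Prop. 2.2.6;
folklore] -/
private theorem isSemialgebraicFunOn_avg {n : ℕ} (N : ℕ) {g : (Fin n → ℝ) → ℝ}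
    {U : Set (Fin n → ℝ)} (hsa : IsSemialgebraicFunOn ℚ U g) :
    IsSemialgebraicFunOn ℚ
      (⋂ k ∈ (Finset.univ : Finset (Fin n → Fin N)),
        (fun x : Fin n → ℝ => fun j => ((((k j : Fin N) : ℕ) : ℝ) + x j) / N) ⁻¹' U)
      (fun x => ∑ k : Fin n → Fin N, ((N : ℝ) ^ n)⁻¹ *
        g (fun j => ((((k j : Fin N) : ℕ) : ℝ) + x j) / N)) := by
  classical
  have hUsa : Literature.ModelTheory.ExponentialFields.IsSemialgebraic ℚ U :=
    IsSemialgebraicFunOn.isSemialgebraic_holds hsa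
  -- the grid polynomials
  set P : (Fin n → Fin N) → Fin n → MvPolynomial (Fin n) ℚ := fun k j =>
    MvPolynomial.C ((((k j : Fin N) : ℕ) : ℚ) / N) + MvPolynomial.C ((N : ℚ)⁻¹) * MvPolynomial.X j
    with hP
  have hΦ : ∀ k : Fin n → Fin N, (fun x : Fin n → ℝ => fun j => MvPolynomial.aeval x (P k j)) =
      fun x j => ((((k j : Fin N) : ℕ) : ℝ) + x j) / N := by
    intro k
    funext x j
    exact aeval_gridPoly k x j
  set V : Set (Fin n → ℝ) := ⋂ k ∈ (Finset.univ : Finset (Fin n → Fin N)),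
    (fun x : Fin n → ℝ => fun j => ((((k j : Fin N) : ℕ) : ℝ) + x j) / N) ⁻¹' U with hV
  have hVsa : Literature.ModelTheory.ExponentialFields.IsSemialgebraic ℚ V := by
    refine Literature.ModelTheory.ExponentialFields.IsSemialgebraic.biInter Finset.univ _ fun k _ => ?_
    rw [← hΦ k]
    exact hUsa.preimage_aeval (P k)
  have hVsub : ∀ k : Fin n → Fin N, MapsTo (fun x j => ((((k j : Fin N) : ℕ) : ℝ) + x j) / N) V U :=
    fun k x hx => Set.mem_iInter₂.mp hx k (Finset.mem_univ k)
  refine isSemialgebraicFunOn_finset_sum Finset.univ hVsa fun k _ => ?_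
  have hmap : IsSemialgebraicMapOn ℚ V (fun x j => ((((k j : Fin N) : ℕ) : ℝ) + x j) / N) := by
    rw [← hΦ k]
    exact isSemialgebraicMapOn_aeval (R := ℝ) hVsa (P k)
  have hcomp : IsSemialgebraicFunOn ℚ V (fun x => g (fun j => ((((k j : Fin N) : ℕ) : ℝ) + x j) / N)) :=
    IsSemialgebraicFunOn.comp_isSemialgebraicMapOn_holds hsa hmap (hVsub k)
  have hcst : IsSemialgebraicFunOn ℚ V (fun _ : Fin n → ℝ => ((N : ℝ) ^ n)⁻¹) :=
    (isSemialgebraicFunOn_aeval (R := ℝ) hVsa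
      (MvPolynomial.C (((N : ℚ) ^ n)⁻¹) : MvPolynomial (Fin n) ℚ)).congr fun x _ => by simp
  exact IsSemialgebraicFunOn.mul_holds hcst hcomp

/-! ## The power series of the average at the corner -/

/-- **The average has a power series at `0` of sup-radius `N δ`.** If `f` has a power series
expansion of radius `δ` around every point of the cube, then `x ↦ ∑ₖ N⁻ⁿ f((k + x)/N)` has one at
`0` of radius `N δ` (each summand is `f` re-expanded around `k/N ∈ [0,1]ⁿ` and rescaled by `N`).
[Krantz–Parks 2002, §2.2; folklore] -/
private theorem hasFPowerSeriesOnBall_avg {n : ℕ} {f : (Fin n → ℝ) → ℝ} {δ : ℝ≥0} (hδ : 0 < δ)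
    (hf : ∀ x ∈ KZ.cube n, ∃ q : FormalMultilinearSeries ℝ (Fin n → ℝ) ℝ,
      HasFPowerSeriesOnBall f q x δ)
    {N : ℕ} (hN : 0 < N) :
    ∃ p : FormalMultilinearSeries ℝ (Fin n → ℝ) ℝ,
      HasFPowerSeriesOnBall (fun x => ∑ k : Fin n → Fin N, ((N : ℝ) ^ n)⁻¹ *
        f (fun j => ((((k j : Fin N) : ℕ) : ℝ) + x j) / N)) p 0
        (((N : ℝ≥0) * δ : ℝ≥0) : ℝ≥0∞) := by
  -- adapted from `admOfTame_hasFPowerSeriesOnBall_avg` (…SectorToKernelAdmissibleOfTame.lean)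
  classical
  choose q hq using fun k : Fin n → Fin N => hf _ (gridPoint_mem_cube k)
  have hr : (0 : ℝ≥0∞) < (((N : ℝ≥0) * δ : ℝ≥0) : ℝ≥0∞) := by
    exact_mod_cast mul_pos (by exact_mod_cast hN) hδ
  have key : ∀ k : Fin n → Fin N,
      HasFPowerSeriesOnBall (fun x => ((N : ℝ) ^ n)⁻¹ *
          f (fun j => ((((k j : Fin N) : ℕ) : ℝ) + x j) / N))
        (((N : ℝ) ^ n)⁻¹ • (q k).compContinuousLinearMap
          ((N : ℝ)⁻¹ • ContinuousLinearMap.id ℝ (Fin n → ℝ))) 0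
        (((N : ℝ≥0) * δ : ℝ≥0) : ℝ≥0∞) := by
    intro k
    have h1 := (admOfTame_hasFPowerSeriesOnBall_rescale hδ (hq k) hN).const_smul
      (c := ((N : ℝ) ^ n)⁻¹)
    have hfun : (((N : ℝ) ^ n)⁻¹ • fun x : Fin n → ℝ =>
        f ((fun j => (((k j : Fin N) : ℕ) : ℝ) / N) + (N : ℝ)⁻¹ • x)) =
        fun x => ((N : ℝ) ^ n)⁻¹ * f (fun j => ((((k j : Fin N) : ℕ) : ℝ) + x j) / N) := by
      funext x
      simp only [Pi.smul_apply, smul_eq_mul]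
      congr 2
      funext j
      simp only [Pi.add_apply, Pi.smul_apply, smul_eq_mul]
      ring
    rw [hfun] at h1
    exact h1
  exact ⟨_, admOfTame_hasFPowerSeriesOnBall_sum Finset.univ hr fun k _ => key k⟩

/-! ## The stub -/

/-- STUB (N₂) Nash cube ⇒ ONE germ cube: a closed-cube representation whose integrand is
`ℚ`-semialgebraic and real-analytic near the closed cube is KZ-equivalent to a closed-cube
representation (same dimension) whose integrand is, on the closed cube, the sum of a real power
series `Σₐ cₐ xᵃ` at the corner with `Σₐ |cₐ| Rᵃ < ∞` for some `R > 1`, and is `ℚ`-semialgebraic on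
an open neighbourhood of the closed cube. (Uniform radius of convergence on the compact cube by
`HasFPowerSeriesOnBall.changeOrigin`; `j` rounds of dyadic subdivision along each coordinate — rule
(1a) across the null hyperplanes `xᵢ = ½` and rule (2) for the affine rescalings of Jacobian `½` —,
the `2^{jn}` rescaled pieces summed into one integrand by integrand additivity (rule 1b); the
average has a power series at the corner of sup-radius `2ʲδ > 2n`, regrouped by monomials.)
[cite: KontsevichZagier2001, §1.2] -/
theorem stub_nashToGerm :
    ∀ (n : ℕ) (g : (Fin n → ℝ) → ℝ) (U : Set (Fin n → ℝ)) (s : IntegralRep n),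
      IsOpen U → Set.pi Set.univ (fun _ : Fin n => Set.Icc (0:ℝ) 1) ⊆ U →
      IsSemialgebraicFunOn ℚ U g → AnalyticOnNhd ℝ g U →
      s.domain = Set.pi Set.univ (fun _ : Fin n => Set.Icc (0:ℝ) 1) →
      (∀ z ∈ Set.pi Set.univ (fun _ : Fin n => Set.Icc (0:ℝ) 1), s.integrand z = g z) →
      ∃ (h : (Fin n → ℝ) → ℝ) (V : Set (Fin n → ℝ)) (c : (Fin n →₀ ℕ) → ℝ) (R : ℝ)
        (t : IntegralRep n),
        IsOpen V ∧ Set.pi Set.univ (fun _ : Fin n => Set.Icc (0:ℝ) 1) ⊆ V ∧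
        IsSemialgebraicFunOn ℚ V h ∧ 1 < R ∧
        Summable (fun a : Fin n →₀ ℕ => |c a| * R ^ a.degree) ∧
        (∀ x ∈ Set.pi Set.univ (fun _ : Fin n => Set.Icc (0:ℝ) 1),
          HasSum (fun a : Fin n →₀ ℕ => c a * ∏ j, x j ^ a j) (h x)) ∧
        t.domain = Set.pi Set.univ (fun _ : Fin n => Set.Icc (0:ℝ) 1) ∧
        (∀ x ∈ Set.pi Set.univ (fun _ : Fin n => Set.Icc (0:ℝ) 1), t.integrand x = h x) ∧
        of s - of t ∈ relations := by
  classical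
  intro n g U s hUo hUsub hsa hga hsd hsi
  -- the closed cube `KZ.cube n = Set.pi univ (Icc 0 1)` inside `U`
  have hcU : KZ.cube n ⊆ U := fun x hx => hUsub (by rwa [← KZ.cube_eq_pi])
  have hf : AnalyticOnNhd ℝ g (KZ.cube n) ∧ IsSemialgebraicFunOn ℚ (KZ.cube n) g :=
    ⟨hga.mono hcU, hsa.mono hcU KZ.isSemialgebraic_cube⟩
  -- (1) a uniform radius of convergence on the compact cube
  obtain ⟨δ, hδ, hfδ⟩ := admOfTame_exists_uniform_radius KZ.isCompact_cube hf.1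
  -- (2) the subdivision depth `j`, `2ʲ δ > 2 n`
  obtain ⟨j, hj⟩ : ∃ j : ℕ, (n : ℝ≥0) * 2 / δ < 2 ^ j := pow_unbounded_of_one_lt _ one_lt_two
  have hN : 0 < 2 ^ j := pow_pos two_pos j
  -- the averaged integrand, its tame cube class, and the moves
  have hG := admOfTame_tame_avg (2 ^ j) hf
  have hrel : of s - of (IntegralRep.tameCube _ hG.1 hG.2) ∈ relations := by
    have h1 : of s - of (IntegralRep.tameCube g hf.1 hf.2) ∈ relations := by
      refine of_sub_of_mem_relations_of_eqOn ?_ fun x hx => ?_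
      · show KZ.cube n = s.domain
        rw [hsd, KZ.cube_eq_pi]
      · rw [hsd] at hx
        exact hsi x hx
    exact admOfTame_rel_trans h1 (admOfTame_rel_avg j hf hG (fun x => rfl))
  -- (3) the power series of the average at the corner, regrouped by monomials
  obtain ⟨p, hp⟩ := hasFPowerSeriesOnBall_avg hδ hfδ hN
  have hR : (((n : ℝ≥0) * 2 : ℝ≥0) : ℝ≥0∞) < ((((2 ^ j : ℕ) : ℝ≥0) * δ : ℝ≥0) : ℝ≥0∞) := by
    rw [ENNReal.coe_lt_coe, Nat.cast_pow, Nat.cast_ofNat]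
    rwa [div_lt_iff₀ hδ] at hj
  obtain ⟨F, hFs, hFsum⟩ := admOfTame_exists_mvPowerSeries hp (ρ := 2) one_le_two hR
  -- (4) the open semialgebraic neighbourhood `V = ⋂ₖ Φₖ⁻¹ U` of the cube
  have hVsa := isSemialgebraicFunOn_avg (n := n) (2 ^ j) hsa
  refine ⟨_, ⋂ k ∈ (Finset.univ : Finset (Fin n → Fin (2 ^ j))),
      (fun x : Fin n → ℝ => fun i => ((((k i : Fin (2 ^ j)) : ℕ) : ℝ) + x i) / (2 ^ j : ℕ)) ⁻¹' U,
    fun a => MvPowerSeries.coeff a F, 2, IntegralRep.tameCube _ hG.1 hG.2, ?_, ?_, hVsa,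
    one_lt_two, ?_, ?_, KZ.cube_eq_pi n, fun x _ => rfl, hrel⟩
  · -- `V` is open
    exact isOpen_biInter_finset fun k _ =>
      hUo.preimage (continuous_pi fun i => (continuous_const.add (continuous_apply i)).div_const _)
  · -- the closed cube lies in `V`
    intro x hx
    have hxc : x ∈ KZ.cube n := by rwa [KZ.cube_eq_pi]
    exact Set.mem_iInter₂.mpr fun k _ => hcU (gridMap_mem_cube k hxc)
  · -- absolute convergence at the polyradius `2`
    refine hFs.congr fun a => ?_
    simp only [NNReal.coe_ofNat, Finsupp.degree_apply]
    rfl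
  · -- the power series sums to the average on the closed cube
    intro x hx
    have hx' : ∀ i, 0 ≤ x i ∧ x i ≤ 1 := fun i => mem_Icc.1 (mem_univ_pi.1 hx i)
    have h := hFsum x hx'
    simp only [Finsupp.prod_pow] at h
    exact h

end Summit.KontsevichZagierPeriods.KontsevichZagierPeriods.StokesGenerationLine
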